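import Summits.QuantumFields.BalabanUV.Beta.EriceRemainderEnclosureHistoryUniqueness
import Summits.QuantumFields.BalabanUV.Beta.EriceRemainderEnclosureHistoryRenewal
import Summits.QuantumFields.BalabanUV.Beta.EriceRemainderEnclosureHistoryRenewalBlocks

/-!
# EriceRemainderEnclosureHistoryRenewalUniform — (E33f) K-UNIFORM WITHOUT `FadingMemory`: with DYADIC windows (row `l` looks back
# `l∕2` scales) the renewal of (E33) closes uniformly in the cutoff — `|1∕(g^A_j)² − 1∕(g^B_{j+1})²| ≤ (C₂·log₂j + D)·max(θ,q)^{log₂j}`,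
# NO factor `K`: the decay of the memory buys the GEOMETRIC shape of node U2's rate, not its K-uniformity

Cell `pub-balaban`, β-function sub-cell, BINDER row D4 «RemainderConst leaves for Bałaban's split» (`HOME/BINDER-OWNERS.md`; owner
lineage `b2b-balaban-beta-an4`; this file by co-owner #2 lineage `b2b-balaban-beta-d4-p2`, generation 35), β-FLOW TEAM duty (1),
FREEZE (0) honoured (def-free; no new leaf, no new hypothesis shape).  Answer to the OWNER's reading remark on station (E33) (W-an4-g84-7,
`HOME/INBOX.md`): (E33c)'s stretched rate `c∕((1−θ)(1−q))·(2K+2)·max(θ,q)^⌊√j⌋` carries the cutoff `K` (a matching rate at GROWING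
`j = K − m`, enough for existence (E33d), NOT a K-uniform rate at fixed `j` like node U2's `InjectedRate C 0 θ`).  Here: the factor `K`
is an artefact of the FIXED window — it came from summing the window-independent deletion term over `≤ K` rows; with the window of row
`l` chosen as `l∕2` the deletion terms `2cθ^{l∕2}∕(1−θ)` are themselves summable over the rows and the renewal closes DYADICALLY,
uniformly in `K`.  By-name inputs: (E33a) `EriceRemainderEnclosureHistoryRenewal.disc_row_split` ∕ `disc_row_full` (the row split for
ANY window), (E33b) `EriceRemainderEnclosureHistoryRenewalBlocks.backward_sum_from` ∕ `bound_of_split`, (E32)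
`EriceRemainderEnclosureHistoryUniqueness.nearMono_of_sign` ∕ `nearMono_of_eventualLower`, node U2's
`T4CouplingMatching.sum_weights_le_of_eventualLower`.

HONEST FRAMING (page 1, verbatim and binding).  *"Discharging BetaPertH makes Bałaban's UV stability UNCONDITIONAL — a real
constructive-QFT result; it is NOT the continuum limit and NOT the Clay problem."*  THIS FILE DISCHARGES NOTHING OF THE KIND.  Every
β-side input is a NAMED BINDER on an ABSTRACT family `β : FlowStep.HBeta` (node U2's `ScaleShiftRate`, `HistLipschitz` with a row total
weight, `EventualLowerH`, the sign or the two-sided bound — NOT PRINTED, GAPS G-t4-U2-1∕-2, NOT asserted for [I] (1.22)); [folklore] real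
analysis + by-name composition; nothing of [I] quoted newly.  Row D4 class UNCHANGED (critical-path width 0; instance 0∕1; D4 DISCHARGE NO
DATE).  HONEST DEPENDENCY: continuum YM on T⁴ ⇐ BetaPertH ∧ nine spine estimates (0/9 proved); BetaPertH ⇐ (D1) ∧ (D4) ∧ CAP+tail; G-an2-4
gates asym, D1 and NE2/3/4.

THE MECHANISM.  Row split with window `l∕2` ((E33a), any window): `δ_l ≤ δ_{l+1} + a_l + m·w_l·B′`, `a_l = cθ^l + 2cθ^{l∕2}∕(1−θ)`, for any
bound `B′` of `δ` on `[l∕2, l]`.  HALVING STEP (§1 `halving_step`): summing the rows `l ≥ i`, every window lies in `[i∕2, K]`, so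
`E(i) ≤ A(i) + q·E(i∕2)` with `E(i) = max_{[i,K]} δ`, `A(i) = Σ_{l∈[i,K)} a_l`, `q = m·U`.  DYADIC ITERATION (§1 `dyadic_bound`): if
`A(2^{p+1}) ≤ C₂·ρ^{p+1}` (`0 ≤ ρ ≤ 1`) and `δ ≤ D` globally, then `δ_j ≤ (C₂·n + D)·max(ρ,q)^n` for `2^n ≤ j ≤ K` — by induction on `n`,
NO `K` anywhere.  SOURCE SUMS (§2): `Σ_{l∈[i,K)} θ^{l∕2} ≤ 2θ^{i∕2}∕(1−θ)` (pair `l = 2s, 2s+1`), so `A(2^{p+1}) ≤ (c∕(1−θ) + 4c∕(1−θ)²)·θ^{2^p}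
≤ C₂·θ^{p+1}` (`2^p ≥ p + 1`).  RUN LEVEL (§3): `disc_le_dyadic` ∕ **`disc_le_log`** (`1 ≤ j ≤ K`:
`disc_j ≤ (C₂·log₂ j + D)·max(θ,q)^{log₂ j}`, `Nat.log 2`, K-FREE; `D = c∕((1−θ)(1−q))`, `C₂ = c∕(1−θ) + 4c∕(1−θ)²`), **`disc_le_log_sign`**
(`A = 1`, `M·U < 1`), **`disc_le_log_eventual`** (`A = √2`, `2√2·M·U < 1`).  The shape `(log₂ j)·r^{log₂ j} ≈ j^{−log₂(1∕r)}·log j` is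
QUASI-POLYNOMIAL in the ultraviolet index — K-uniform like node U2's, but not geometric: what `FadingMemory` buys is the geometric SHAPE
`θ^j`, and with it the summability of `T4CauchySum.delta` at a geometric rate; uniformity in the cutoff it does not buy.  Whether a
K-uniform GEOMETRIC rate holds without decay of the memory is NOT decided here (the dyadic exponent `log₂(1∕r)` is not optimised; the
companion (E33g) `EriceRemainderEnclosureHistoryRenewalStretched` runs the same renewal with windows `⌊√l⌋` and obtains the K-uniform
STRETCHED-EXPONENTIAL form `L·ρ^⌊√j⌋`, `θ < ρ < 1`, `q ≤ ρ²`, with `L` given through a convergent series; this file's constants are explicit).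
-/

noncomputable section
open Finset

namespace Summit.QuantumFields.BalabanUV.Beta.EriceRemainderEnclosureHistoryRenewalUniform

open Literature.MathematicalPhysics.QuantumFieldTheory.Balaban1983to89
open Literature.MathematicalPhysics.QuantumFieldTheory.Balaban1983to89.FlowStep
open Literature.MathematicalPhysics.QuantumFieldTheory.Balaban1983to89.T4CouplingMatching
open Summit.QuantumFields.BalabanUV.Beta.EriceRemainderEnclosureHistoryUniqueness
  (nearMono_of_sign sign_along_of_betaLowerH nearMono_of_eventualLower)
open Summit.QuantumFields.BalabanUV.Beta.EriceRemainderEnclosureHistoryRenewal (disc_row_split disc_row_full)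
open Summit.QuantumFields.BalabanUV.Beta.EriceRemainderEnclosureHistoryRenewalBlocks (backward_sum_from bound_of_split)

/-! ## §1 The dyadic renewal (abstract real sequences) -/

/-- **HALVING STEP**: if every row `l < K` splits as `δ_l ≤ δ_{l+1} + a_l + m·w_l·B′` for any bound `B′` of `δ` on the dyadic window
`[l∕2, l]`, and `B ≥ 0` bounds `δ` on `[i∕2, K]`, then `δ_j ≤ Σ_{l∈[i,K)} a_l + m·U·B` for every `j ∈ [i, K]` (`Σ_{j≤K} w_j ≤ U`, data
nonnegative, `δ_K = 0`) — the renewal `E(i) ≤ A(i) + q·E(i∕2)`, NO cutoff factor. [folklore] -/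
theorem halving_step {K : ℕ} {δ a w : ℕ → ℝ} {m U B : ℝ}
    (hw : ∀ i, i ≤ K → 0 ≤ w i) (hm : 0 ≤ m) (ha : ∀ i, 0 ≤ a i)
    (hU : ∑ j ∈ range (K + 1), w j ≤ U) (hK : δ K = 0) (hB : 0 ≤ B)
    (hrec : ∀ l, l < K → ∀ B' : ℝ, (∀ i, l / 2 ≤ i → i ≤ l → δ i ≤ B') → δ l ≤ δ (l + 1) + a l + m * w l * B')
    {i : ℕ} (hbound : ∀ i', i / 2 ≤ i' → i' ≤ K → δ i' ≤ B) :
    ∀ j, i ≤ j → j ≤ K → δ j ≤ (∑ l ∈ Ico i K, a l) + m * U * B := by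
  have hstep : ∀ l, i ≤ l → l < K → δ l ≤ δ (l + 1) + (a l + m * w l * B) := by
    intro l hil hlK
    have h := hrec l hlK B (fun i' hi1 hi2 => hbound i' ((Nat.div_le_div_right hil).trans hi1) (by omega))
    linarith
  intro j hij hjK
  have h1 := backward_sum_from (s := fun l => a l + m * w l * B) (le_of_eq hK) hstep j hij hjK
  have h2 : ∑ l ∈ Ico j K, (a l + m * w l * B) = (∑ l ∈ Ico j K, a l) + m * B * ∑ l ∈ Ico j K, w l := by
    rw [sum_add_distrib, mul_sum]; exact congrArg _ (sum_congr rfl fun l _ => by ring)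
  have h3 : ∑ l ∈ Ico j K, a l ≤ ∑ l ∈ Ico i K, a l :=
    sum_le_sum_of_subset_of_nonneg (Ico_subset_Ico hij le_rfl) fun l _ _ => ha l
  have h4 : ∑ l ∈ Ico j K, w l ≤ U :=
    (sum_le_sum_of_subset_of_nonneg (fun l hl => mem_range.mpr (by have := (mem_Ico.mp hl).2; omega))
      (fun l hl _ => hw l (Nat.lt_succ_iff.mp (mem_range.mp hl)))).trans hU
  have h5 : m * B * ∑ l ∈ Ico j K, w l ≤ m * B * U := mul_le_mul_of_nonneg_left h4 (mul_nonneg hm hB)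
  calc δ j ≤ ∑ l ∈ Ico j K, (a l + m * w l * B) := h1
    _ = (∑ l ∈ Ico j K, a l) + m * B * ∑ l ∈ Ico j K, w l := h2
    _ ≤ (∑ l ∈ Ico i K, a l) + m * U * B := by nlinarith [h3, h5]

/-- **DYADIC ITERATION, K-FREE**: under the halving split, a global bound `0 ≤ δ ≤ D` on `[0, K]`, and source sums
`Σ_{l∈[2^{p+1},K)} a_l ≤ C₂·ρ^{p+1}` (`C₂ ≥ 0`, `ρ ≥ 0`), with `q = m·U ≥ 0`: for every `n` and every `j` with `2^n ≤ j ≤ K`,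
`δ_j ≤ (C₂·n + D)·max(ρ, q)^n` (induction on `n`: `(C₂(n+1) + D)·r^{n+1} ≥ C₂ρ^{n+1} + q·(C₂n + D)·r^n`). [folklore] -/
theorem dyadic_bound {K : ℕ} {δ a w : ℕ → ℝ} {m U D C₂ ρ : ℝ}
    (hw : ∀ i, i ≤ K → 0 ≤ w i) (hm : 0 ≤ m) (ha : ∀ i, 0 ≤ a i)
    (hU : ∑ j ∈ range (K + 1), w j ≤ U) (hU0 : 0 ≤ U) (hK : δ K = 0)
    (hD0 : 0 ≤ D) (hδD : ∀ i, i ≤ K → δ i ≤ D) (hC₂ : 0 ≤ C₂) (hρ0 : 0 ≤ ρ)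
    (hA : ∀ p : ℕ, 2 ^ (p + 1) ≤ K → ∑ l ∈ Ico (2 ^ (p + 1)) K, a l ≤ C₂ * ρ ^ (p + 1))
    (hrec : ∀ l, l < K → ∀ B' : ℝ, (∀ i, l / 2 ≤ i → i ≤ l → δ i ≤ B') → δ l ≤ δ (l + 1) + a l + m * w l * B') :
    ∀ (n j : ℕ), 2 ^ n ≤ j → j ≤ K → δ j ≤ (C₂ * (n : ℝ) + D) * (max ρ (m * U)) ^ n := by
  have hq0 : 0 ≤ m * U := mul_nonneg hm hU0
  have hr0 : 0 ≤ max ρ (m * U) := hρ0.trans (le_max_left _ _)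
  intro n
  induction n with
  | zero => intro j _ hjK; simpa using hδD j hjK
  | succ n ih =>
    intro j hj hjK
    set r := max ρ (m * U) with hr
    have hB0 : 0 ≤ (C₂ * (n : ℝ) + D) * r ^ n := mul_nonneg (by positivity) (pow_nonneg hr0 n)
    -- the halving step from i = 2^(n+1), with B = the level-n bound on [2^n, K]
    have hhalf := halving_step (i := 2 ^ (n + 1)) hw hm ha hU hK hB0 hrec
      (fun i' hi1 hi2 => ih i' (by rw [Nat.pow_succ, Nat.mul_div_cancel _ (by norm_num : 0 < 2)] at hi1; exact hi1) hi2) j hj hjK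
    have hAK := hA n (hj.trans hjK)
    have hρr : ρ ^ (n + 1) ≤ r ^ (n + 1) := pow_le_pow_left₀ hρ0 (le_max_left _ _) _
    have hqr : m * U * r ^ n ≤ r ^ (n + 1) := by
      rw [pow_succ]; nlinarith [le_max_right ρ (m * U), pow_nonneg hr0 n]
    calc δ j ≤ (∑ l ∈ Ico (2 ^ (n + 1)) K, a l) + m * U * ((C₂ * (n : ℝ) + D) * r ^ n) := hhalf
      _ ≤ C₂ * ρ ^ (n + 1) + (C₂ * (n : ℝ) + D) * (m * U * r ^ n) := by nlinarith [hAK]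
      _ ≤ C₂ * r ^ (n + 1) + (C₂ * (n : ℝ) + D) * r ^ (n + 1) :=
          add_le_add (mul_le_mul_of_nonneg_left hρr hC₂) (mul_le_mul_of_nonneg_left hqr (by positivity))
      _ = (C₂ * (((n + 1 : ℕ) : ℝ)) + D) * r ^ (n + 1) := by push_cast; ring

/-! ## §2 The dyadic source sums are K-uniform -/

/-- Pairing `d = 2s, 2s+1`: `Σ_{d<2R} θ^{d∕2} = 2·Σ_{s<R} θ^s` (ℕ-division). [folklore] -/
theorem sum_range_pow_half (θ : ℝ) (R : ℕ) : ∑ d ∈ range (2 * R), θ ^ (d / 2) = 2 * ∑ s ∈ range R, θ ^ s := by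
  induction R with
  | zero => simp
  | succ R ih =>
    rw [show 2 * (R + 1) = 2 * R + 1 + 1 by ring, sum_range_succ, sum_range_succ, ih, sum_range_succ,
      show (2 * R) / 2 = R by omega, show (2 * R + 1) / 2 = R by omega]
    ring

/-- `Σ_{l∈[i,K)} θ^{l∕2} ≤ 2θ^{i∕2}∕(1−θ)` for `0 ≤ θ < 1` (`(i+d)∕2 ≥ i∕2 + d∕2` and the pairing). [folklore] -/
theorem sum_Ico_pow_half_le {θ : ℝ} (hθ0 : 0 ≤ θ) (hθ1 : θ < 1) (i K : ℕ) :
    ∑ l ∈ Ico i K, θ ^ (l / 2) ≤ 2 * θ ^ (i / 2) / (1 - θ) := by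
  have hθ1' : θ ≤ 1 := hθ1.le
  rw [sum_Ico_eq_sum_range]
  calc ∑ d ∈ range (K - i), θ ^ ((i + d) / 2) ≤ ∑ d ∈ range (K - i), θ ^ (i / 2) * θ ^ (d / 2) := by
        refine sum_le_sum fun d _ => ?_
        rw [← pow_add]
        exact pow_le_pow_of_le_one hθ0 hθ1' (Nat.add_div_le_add_div i d 2)
    _ = θ ^ (i / 2) * ∑ d ∈ range (K - i), θ ^ (d / 2) := by rw [mul_sum]
    _ ≤ θ ^ (i / 2) * ∑ d ∈ range (2 * (K - i)), θ ^ (d / 2) :=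
        mul_le_mul_of_nonneg_left (sum_le_sum_of_subset_of_nonneg (range_mono (by omega)) fun d _ _ => pow_nonneg hθ0 _)
          (pow_nonneg hθ0 _)
    _ = θ ^ (i / 2) * (2 * ∑ s ∈ range (K - i), θ ^ s) := by rw [sum_range_pow_half]
    _ ≤ θ ^ (i / 2) * (2 * (1 / (1 - θ))) := by
        refine mul_le_mul_of_nonneg_left (mul_le_mul_of_nonneg_left ?_ (by norm_num)) (pow_nonneg hθ0 _)
        rw [← Nat.Ico_zero_eq_range]
        simpa using geom_sum_Ico_le_of_lt_one hθ0 hθ1 (m := 0) (n := K - i)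
    _ = 2 * θ ^ (i / 2) / (1 - θ) := by ring

/-- **THE DYADIC SOURCE SUM**: with `a_l = cθ^l + 2cθ^{l∕2}∕(1−θ)`, `Σ_{l∈[2^{p+1},K)} a_l ≤ (c∕(1−θ) + 4c∕(1−θ)²)·θ^{p+1}` for every `K`
(`θ^{2^{p+1}} ≤ θ^{2^p} ≤ θ^{p+1}` since `2^p ≥ p + 1`). [folklore] -/
theorem dyadic_source_le {c θ : ℝ} (hc : 0 ≤ c) (hθ0 : 0 ≤ θ) (hθ1 : θ < 1) (p K : ℕ) :
    ∑ l ∈ Ico (2 ^ (p + 1)) K, (c * θ ^ l + 2 * (c * θ ^ (l / 2) / (1 - θ)))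
      ≤ (c / (1 - θ) + 4 * c / (1 - θ) ^ 2) * θ ^ (p + 1) := by
  have h1θ : 0 < 1 - θ := by linarith
  have hθ1' : θ ≤ 1 := hθ1.le
  have hp : p + 1 ≤ 2 ^ p := Nat.lt_two_pow_self
  have hpow1 : θ ^ (2 ^ (p + 1)) ≤ θ ^ (p + 1) := pow_le_pow_of_le_one hθ0 hθ1' (by rw [Nat.pow_succ]; omega)
  have hpow2 : θ ^ (2 ^ (p + 1) / 2) ≤ θ ^ (p + 1) :=
    pow_le_pow_of_le_one hθ0 hθ1' (by rw [Nat.pow_succ, Nat.mul_div_cancel _ (by norm_num : 0 < 2)]; exact hp)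
  rw [sum_add_distrib]
  have hs1 : ∑ l ∈ Ico (2 ^ (p + 1)) K, c * θ ^ l ≤ c / (1 - θ) * θ ^ (p + 1) := by
    rw [← mul_sum]
    calc c * ∑ l ∈ Ico (2 ^ (p + 1)) K, θ ^ l ≤ c * (θ ^ (2 ^ (p + 1)) / (1 - θ)) :=
          mul_le_mul_of_nonneg_left (geom_sum_Ico_le_of_lt_one hθ0 hθ1) hc
      _ ≤ c * (θ ^ (p + 1) / (1 - θ)) := mul_le_mul_of_nonneg_left (div_le_div_of_nonneg_right hpow1 h1θ.le) hc
      _ = c / (1 - θ) * θ ^ (p + 1) := by ring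
  have hs2 : ∑ l ∈ Ico (2 ^ (p + 1)) K, 2 * (c * θ ^ (l / 2) / (1 - θ)) ≤ 4 * c / (1 - θ) ^ 2 * θ ^ (p + 1) := by
    have e : ∑ l ∈ Ico (2 ^ (p + 1)) K, 2 * (c * θ ^ (l / 2) / (1 - θ))
        = 2 * c / (1 - θ) * ∑ l ∈ Ico (2 ^ (p + 1)) K, θ ^ (l / 2) := by
      rw [mul_sum]; exact sum_congr rfl fun l _ => by ring
    rw [e]
    calc 2 * c / (1 - θ) * ∑ l ∈ Ico (2 ^ (p + 1)) K, θ ^ (l / 2)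
        ≤ 2 * c / (1 - θ) * (2 * θ ^ (2 ^ (p + 1) / 2) / (1 - θ)) :=
          mul_le_mul_of_nonneg_left (sum_Ico_pow_half_le hθ0 hθ1 _ _) (by positivity)
      _ ≤ 2 * c / (1 - θ) * (2 * θ ^ (p + 1) / (1 - θ)) :=
          mul_le_mul_of_nonneg_left (div_le_div_of_nonneg_right (by linarith) h1θ.le) (by positivity)
      _ = 4 * c / (1 - θ) ^ 2 * θ ^ (p + 1) := by field_simp; ring
  calc ∑ l ∈ Ico (2 ^ (p + 1)) K, c * θ ^ l + ∑ l ∈ Ico (2 ^ (p + 1)) K, 2 * (c * θ ^ (l / 2) / (1 - θ))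
      ≤ c / (1 - θ) * θ ^ (p + 1) + 4 * c / (1 - θ) ^ 2 * θ ^ (p + 1) := add_le_add hs1 hs2
    _ = (c / (1 - θ) + 4 * c / (1 - θ) ^ 2) * θ ^ (p + 1) := by ring

/-! ## §3 Run level: node U2's matching WITHOUT `FadingMemory`, uniformly in the cutoff -/

/-- **TWO RUNS, DYADIC FORM, K-FREE.**  Node U2's `disc_le_of_fadingMemory` binder list (runs of `K` and `K + 1` steps of (0.20) in ]0,γ],
same `β`, pinned; `ScaleShiftRate c θ γ β`, `c ≥ 0`, `0 ≤ θ < 1`; `HistLipschitz Λ γ β`) with `FadingMemory C θ Λ` REPLACED by «`Λ ≥ 0`,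
rows `Σ_{i≤k} Λ k i ≤ M`» + near-monotone runs (constant `A`) + `Σ u ≤ U` and SMALLNESS `q = A³·M·U < 1`.  THEN for every `n` and every
`j` with `2^n ≤ j ≤ K`: `disc gA gB j ≤ (C₂·n + D)·max(θ,q)^n`, `C₂ = c∕(1−θ) + 4c∕(1−θ)²`, `D = c∕((1−θ)(1−q))` — NO `K` on the right.
[cite: Balaban1987RG1, (0.20) p.256 and §5 p.298] -/
theorem disc_le_dyadic {β : HBeta} {γ c θ M A U : ℝ} {Λ : ℕ → ℕ → ℝ} {K : ℕ} {gA gB : ℕ → ℝ}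
    (hc : 0 ≤ c) (hθ0 : 0 ≤ θ) (hθ1 : θ < 1)
    (hA : RGEqH K β gA) (hB : RGEqH (K + 1) β gB)
    (hAbox : ∀ i, i ≤ K → 0 < gA i ∧ gA i ≤ γ) (hBbox : ∀ i, i ≤ K + 1 → 0 < gB i ∧ gB i ≤ γ)
    (hpin : gA K = gB (K + 1))
    (hS : ScaleShiftRate c θ γ β) (hL : HistLipschitz Λ γ β) (hΛ : ∀ k i, i ≤ k → 0 ≤ Λ k i) (hM : 0 ≤ M)
    (hrow : ∀ k, ∑ i ∈ range (k + 1), Λ k i ≤ M) (hA0 : 0 ≤ A)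
    (hmA : ∀ i j, i ≤ j → j ≤ K → gA i ≤ A * gA j) (hmB : ∀ i j, i ≤ j → j ≤ K + 1 → gB i ≤ A * gB j)
    (hU : ∑ i ∈ range (K + 1), (gA i) ^ 2 * gB (i + 1) ≤ U) (hsmall : A ^ 3 * M * U < 1) :
    ∀ (n j : ℕ), 2 ^ n ≤ j → j ≤ K → disc gA gB j
      ≤ ((c / (1 - θ) + 4 * c / (1 - θ) ^ 2) * (n : ℝ) + c / ((1 - θ) * (1 - A ^ 3 * M * U))) * (max θ (A ^ 3 * M * U)) ^ n := by
  have h1θ : 0 < 1 - θ := by linarith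
  have hw : ∀ i, i ≤ K → 0 ≤ (gA i) ^ 2 * gB (i + 1) := fun i hi => mul_nonneg (sq_nonneg _) (hBbox (i + 1) (by omega)).1.le
  have hU0 : 0 ≤ U := (sum_nonneg fun i hi => hw i (Nat.lt_succ_iff.mp (mem_range.mp hi))).trans hU
  have hm : 0 ≤ A ^ 3 * M := mul_nonneg (pow_nonneg hA0 3) hM
  have e3 : A ^ 3 * M * U = (A ^ 3 * M) * U := by ring
  rw [e3] at hsmall ⊢
  have h1q : 0 < 1 - (A ^ 3 * M) * U := by linarith
  -- global bound D from the undeleted split ((E33b) `bound_of_split`)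
  have hS₀ : ∑ l ∈ range K, c * θ ^ l ≤ c / (1 - θ) := by
    rw [← mul_sum]
    calc c * ∑ l ∈ range K, θ ^ l ≤ c * (θ ^ 0 / (1 - θ)) := by
          rw [← Nat.Ico_zero_eq_range]; exact mul_le_mul_of_nonneg_left (geom_sum_Ico_le_of_lt_one hθ0 hθ1) hc
      _ = c / (1 - θ) := by rw [pow_zero]; ring
  have hD := bound_of_split (δ := disc gA gB) (a := fun l => c * θ ^ l) (w := fun i => (gA i) ^ 2 * gB (i + 1)) hw hm
    (fun i => mul_nonneg hc (pow_nonneg hθ0 i)) hU hsmall (disc_pin hpin) (disc_nonneg gA gB) hS₀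
    (fun j hj B' hB' => disc_row_full hA hB hAbox hBbox hS hL hΛ hrow hA0 hmA hmB hj hB')
  have hDeq : c / (1 - θ) / (1 - A ^ 3 * M * U) = c / ((1 - θ) * (1 - A ^ 3 * M * U)) := by rw [div_div]
  refine dyadic_bound (a := fun l => c * θ ^ l + 2 * (c * θ ^ (l / 2) / (1 - θ))) hw hm (fun l => by positivity) hU hU0
    (disc_pin hpin) (div_nonneg hc (mul_pos h1θ h1q).le) (fun i hi => hDeq ▸ hD i hi) (by positivity) hθ0
    (fun p _ => dyadic_source_le hc hθ0 hθ1 p K) ?_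
  intro l hl B' hB'
  have h := disc_row_split (s := l / 2) hc hθ0 hθ1 hA hB hAbox hBbox hS hL hΛ hrow hA0 hmA hmB hl
    (fun i hi1 hi2 => hB' i (by omega) hi2)
  linarith [h]

/-- **NODE U2 WITHOUT FADING MEMORY, UNIFORMLY IN THE CUTOFF** (the `log₂` form): under the binder list of `disc_le_dyadic`, for every
`j` with `1 ≤ j ≤ K`: `|1∕(g^A_j)² − 1∕(g^B_{j+1})²| ≤ (C₂·log₂ j + D)·max(θ,q)^{log₂ j}` (`Nat.log 2`; `2^{log₂ j} ≤ j`) — a bound in the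
ultraviolet index `j` ALONE, quasi-polynomial `≈ j^{−log₂(1∕r)}·log j`: K-uniform like node U2's `(2c∕(1−θ))·θ^j`, but not geometric.
[cite: Balaban1987RG1, (0.20) p.256 and §5 p.298] -/
theorem disc_le_log {β : HBeta} {γ c θ M A U : ℝ} {Λ : ℕ → ℕ → ℝ} {K : ℕ} {gA gB : ℕ → ℝ}
    (hc : 0 ≤ c) (hθ0 : 0 ≤ θ) (hθ1 : θ < 1)
    (hA : RGEqH K β gA) (hB : RGEqH (K + 1) β gB)
    (hAbox : ∀ i, i ≤ K → 0 < gA i ∧ gA i ≤ γ) (hBbox : ∀ i, i ≤ K + 1 → 0 < gB i ∧ gB i ≤ γ)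
    (hpin : gA K = gB (K + 1))
    (hS : ScaleShiftRate c θ γ β) (hL : HistLipschitz Λ γ β) (hΛ : ∀ k i, i ≤ k → 0 ≤ Λ k i) (hM : 0 ≤ M)
    (hrow : ∀ k, ∑ i ∈ range (k + 1), Λ k i ≤ M) (hA0 : 0 ≤ A)
    (hmA : ∀ i j, i ≤ j → j ≤ K → gA i ≤ A * gA j) (hmB : ∀ i j, i ≤ j → j ≤ K + 1 → gB i ≤ A * gB j)
    (hU : ∑ i ∈ range (K + 1), (gA i) ^ 2 * gB (i + 1) ≤ U) (hsmall : A ^ 3 * M * U < 1)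
    {j : ℕ} (hj1 : 1 ≤ j) (hjK : j ≤ K) :
    disc gA gB j ≤ ((c / (1 - θ) + 4 * c / (1 - θ) ^ 2) * ((Nat.log 2 j : ℕ) : ℝ) + c / ((1 - θ) * (1 - A ^ 3 * M * U)))
      * (max θ (A ^ 3 * M * U)) ^ Nat.log 2 j :=
  disc_le_dyadic hc hθ0 hθ1 hA hB hAbox hBbox hpin hS hL hΛ hM hrow hA0 hmA hmB hU hsmall (Nat.log 2 j) j
    (Nat.pow_log_le_self 2 (by omega)) hjK

/-- **END, SIGN FORM, K-FREE** (`A = 1`): sign `BetaLowerH 0 γ β` ((E32) `nearMono_of_sign`), floor `EventualLowerH b γ k₀ β` (node U2's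
`U = (k₀+1)γ³ + 2γ∕b`), smallness `M·U < 1`: for `1 ≤ j ≤ K`, `disc gA gB j ≤ (C₂·log₂ j + c∕((1−θ)(1−MU)))·max(θ, MU)^{log₂ j}` — no `K`,
no `FadingMemory`. [cite: Balaban1987RG1, (0.20) p.256 and (0.31) p.259] -/
theorem disc_le_log_sign {β : HBeta} {γ b c θ M : ℝ} {k₀ : ℕ} {Λ : ℕ → ℕ → ℝ} {K : ℕ} {gA gB : ℕ → ℝ}
    (hγ : 0 < γ) (hb : 0 < b) (hc : 0 ≤ c) (hθ0 : 0 ≤ θ) (hθ1 : θ < 1)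
    (hA : RGEqH K β gA) (hB : RGEqH (K + 1) β gB)
    (hAbox : ∀ i, i ≤ K → 0 < gA i ∧ gA i ≤ γ) (hBbox : ∀ i, i ≤ K + 1 → 0 < gB i ∧ gB i ≤ γ)
    (hpin : gA K = gB (K + 1))
    (hS : ScaleShiftRate c θ γ β) (hL : HistLipschitz Λ γ β) (hΛ : ∀ k i, i ≤ k → 0 ≤ Λ k i) (hM : 0 ≤ M)
    (hrow : ∀ k, ∑ i ∈ range (k + 1), Λ k i ≤ M)
    (hsign : BetaLowerH 0 γ β) (hlo : EventualLowerH b γ k₀ β)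
    (hsmall : M * (((k₀ : ℝ) + 1) * γ ^ 3 + 2 * γ / b) < 1) {j : ℕ} (hj1 : 1 ≤ j) (hjK : j ≤ K) :
    disc gA gB j ≤ ((c / (1 - θ) + 4 * c / (1 - θ) ^ 2) * ((Nat.log 2 j : ℕ) : ℝ)
        + c / ((1 - θ) * (1 - M * (((k₀ : ℝ) + 1) * γ ^ 3 + 2 * γ / b))))
      * (max θ (M * (((k₀ : ℝ) + 1) * γ ^ 3 + 2 * γ / b))) ^ Nat.log 2 j := by
  have hU := sum_weights_le_of_eventualLower hγ hb hA hB hAbox hBbox hlo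
  have hmA := nearMono_of_sign hA (fun k hk => (hAbox k hk).1) (sign_along_of_betaLowerH hsign hAbox)
  have hmB := nearMono_of_sign hB (fun k hk => (hBbox k hk).1) (sign_along_of_betaLowerH hsign hBbox)
  have h := disc_le_log hc hθ0 hθ1 hA hB hAbox hBbox hpin hS hL hΛ hM hrow zero_le_one hmA hmB hU
    (by simpa using hsmall) hj1 hjK
  simpa using h

/-- **END, EVENTUAL FORM, K-FREE** (`A = √2`, no sign): floor `EventualLowerH b γ k₀ β`, lower half `β ≥ −β′` of the PRINTED-type two-sided
bound, `k₀β′γ² ≤ 1∕2` ((E32) `nearMono_of_eventualLower`), smallness `2√2·M·U < 1`: for `1 ≤ j ≤ K`,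
`disc gA gB j ≤ (C₂·log₂ j + c∕((1−θ)(1−2√2·MU)))·max(θ, 2√2·MU)^{log₂ j}` — no `K`, no `FadingMemory`.
[cite: Balaban1987RG1, (0.20) p.256 and §1 p.264] -/
theorem disc_le_log_eventual {β : HBeta} {γ b β' c θ M : ℝ} {k₀ : ℕ} {Λ : ℕ → ℕ → ℝ} {K : ℕ} {gA gB : ℕ → ℝ}
    (hγ : 0 < γ) (hb : 0 < b) (hc : 0 ≤ c) (hθ0 : 0 ≤ θ) (hθ1 : θ < 1)
    (hA : RGEqH K β gA) (hB : RGEqH (K + 1) β gB)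
    (hAbox : ∀ i, i ≤ K → 0 < gA i ∧ gA i ≤ γ) (hBbox : ∀ i, i ≤ K + 1 → 0 < gB i ∧ gB i ≤ γ)
    (hpin : gA K = gB (K + 1))
    (hS : ScaleShiftRate c θ γ β) (hL : HistLipschitz Λ γ β) (hΛ : ∀ k i, i ≤ k → 0 ≤ Λ k i) (hM : 0 ≤ M)
    (hrow : ∀ k, ∑ i ∈ range (k + 1), Λ k i ≤ M)
    (hlo : EventualLowerH b γ k₀ β) (hβ' : 0 ≤ β') (hlow : ∀ k v, v ∈ Box γ k → -β' ≤ β k v)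
    (hk₀ : (k₀ : ℝ) * β' * γ ^ 2 ≤ 1 / 2)
    (hsmall : 2 * Real.sqrt 2 * M * (((k₀ : ℝ) + 1) * γ ^ 3 + 2 * γ / b) < 1) {j : ℕ} (hj1 : 1 ≤ j) (hjK : j ≤ K) :
    disc gA gB j ≤ ((c / (1 - θ) + 4 * c / (1 - θ) ^ 2) * ((Nat.log 2 j : ℕ) : ℝ)
        + c / ((1 - θ) * (1 - 2 * Real.sqrt 2 * M * (((k₀ : ℝ) + 1) * γ ^ 3 + 2 * γ / b))))
      * (max θ (2 * Real.sqrt 2 * M * (((k₀ : ℝ) + 1) * γ ^ 3 + 2 * γ / b))) ^ Nat.log 2 j := by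
  have hU := sum_weights_le_of_eventualLower hγ hb hA hB hAbox hBbox hlo
  have hmA := nearMono_of_eventualLower hA hAbox hb.le hlo hβ' hlow hk₀
  have hmB := nearMono_of_eventualLower hB hBbox hb.le hlo hβ' hlow hk₀
  have hs3 : Real.sqrt 2 ^ 3 = 2 * Real.sqrt 2 := by
    rw [pow_succ, Real.sq_sqrt (by norm_num : (0 : ℝ) ≤ 2)]
  have h := disc_le_log hc hθ0 hθ1 hA hB hAbox hBbox hpin hS hL hΛ hM hrow (Real.sqrt_nonneg 2) hmA hmB hU
    (by rw [hs3]; exact hsmall) hj1 hjK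
  rw [hs3] at h
  exact h

end Summit.QuantumFields.BalabanUV.Beta.EriceRemainderEnclosureHistoryRenewalUniform

end
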